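import Summits.NavierStokesRegularity.NavierStokesRegularity.Theorems.TypeICertificateLadderTargetStrainCubeSharpDepletion
import HarnessLib

/-!
# Crux `Target` = `TypeICertificateLadder.NoTypeIBlowup` (stmt-NavierStokesRegularity-1217), line
# `depletion-ladder`: THE DEPLETION CONSTANT IS GALILEAN — the amplitude is the OSCILLATION of `u`

`--supports stmt-NavierStokesRegularity-1217` (sharpening of the landed
`…StrainCubeSharpDepletion.lean`: same constant `κ = (2+√3)/9`, smaller amplitude).

The stretching integral `J = ∫⟪ω, Du ω⟫`, the enstrophy `Z = ‖ω‖₂²` and the palinstrophy `W = ‖∇ω‖₂²`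
depend on `Du` only, whereas the amplitude `M = sup |u|` of the landed depletion inequality
`|J| ≤ κ M √Z √W` is not invariant under `u ↦ u − c`. The strain-cube chain sees `u` undifferentiated
exactly once, in the integration by parts `∫|S|³ = −∫ u·(S∇|S| + ½|S|Δu)`, and that integrand has zero
mean (`∫ ∂ⱼ(|S| sᵢⱼ) = 0`), so `u` may be replaced there by `u − c` for ANY constant vector `c`:

* `abs_integral_stretching_le_strainCube_galilean` — for a `C^∞` divergence-free `v : ℝ³ → ℝ³` with
  bounded gradient, `D⁰v, D¹v, D²v ∈ L²`, and ANY `c : ℝ³` with `|v − c| ≤ M`: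
  `|∫⟪curl v, Dv (curl v)⟫| ≤ ((2+√3)/9) · M · ‖curl v‖₂ · ‖∇ curl v‖₂`.
  Taking the infimum over `c`, the amplitude is the Chebyshev radius of the range of `v` (between half
  the oscillation and the sup); for a one-signed jet profile it is `½ sup|v|`.

The proof applies the landed sharp interpolation `integral_strainCube_le_sharp` to the translate
`v − c` (same strain, same Laplacian, same Sobolev data of positive order; the translate is not in `L²`,
which that lemma does not require) and the landed Betchov–Miller step / `L²` identities to `v` itself.
Invariance bookkeeping: `fderiv_translate`, `iteratedFDeriv_translate`, `pderiv_apply_translate`,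
`laplacian_translate`, `isDivFree_translate`.

WHAT THIS IS NOT: not a new constant (`κ = (2+√3)/9` as landed); not the crux. [folklore]
-/

noncomputable section

open Set Filter Topology MeasureTheory
open scoped RealInnerProductSpace ENNReal NNReal Laplacian ContDiff
open Literature.Analysis.FluidPDE

namespace Summit.NavierStokesRegularity.NavierStokesRegularity.Theorems.DepletionLadder.StrainCube

-- the problem directory repeats the summit name (`NavierStokesRegularity/NavierStokesRegularity`)
set_option linter.dupNamespace false

open Summit.NavierStokesRegularity.NavierStokesRegularity.Theorems.RungReynoldsOne
open Summit.NavierStokesRegularity.NavierStokesRegularity.Theorems.DepletionLadder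

variable {v : EuclideanSpace ℝ (Fin 3) → EuclideanSpace ℝ (Fin 3)}

/-! ## Translation invariance of everything built from `Dv` -/

/-- `D(v − c) = Dv`. [folklore] -/
theorem fderiv_translate (c : EuclideanSpace ℝ (Fin 3)) :
    fderiv ℝ (fun y => v y - c) = fderiv ℝ v := by
  funext x
  exact fderiv_sub_const c

/-- `Dⁿ(v − c) = Dⁿv` for `n ≥ 1`. [folklore] -/
theorem iteratedFDeriv_translate (c : EuclideanSpace ℝ (Fin 3)) (n : ℕ) :
    iteratedFDeriv ℝ (n + 1) (fun y => v y - c) = iteratedFDeriv ℝ (n + 1) v := by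
  funext x
  rw [iteratedFDeriv_succ_eq_comp_right, iteratedFDeriv_succ_eq_comp_right, Function.comp_apply,
    Function.comp_apply, fderiv_translate]

/-- `∂ⱼ (vᵢ − cᵢ) = ∂ⱼ vᵢ`. [folklore] -/
theorem pderiv_apply_translate (c : EuclideanSpace ℝ (Fin 3)) (i j : Fin 3) :
    pderiv j (fun z => (v z - c) i) = pderiv j (fun z => v z i) := by
  funext x
  rw [pderiv_apply, pderiv_apply]
  have h : (fun z => (v z - c) i) = fun z => v z i - c i := by
    funext z; simp
  rw [h, fderiv_sub_const]

/-- `curl (v − c) = curl v`. [folklore] -/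
theorem curl_translate (c : EuclideanSpace ℝ (Fin 3)) (x : EuclideanSpace ℝ (Fin 3)) :
    curl (fun y => v y - c) x = curl v x := by
  simp only [curl, fderiv_sub_const]

/-- `Δ(v − c) = Δv` for a `C²` field. [folklore] -/
theorem laplacian_translate (hv : ContDiff ℝ 2 v) (c : EuclideanSpace ℝ (Fin 3)) :
    Δ (fun y => v y - c) = Δ v := by
  have hv' : ContDiff ℝ 2 (fun y => v y - c) := hv.sub contDiff_const
  funext x
  ext i
  rw [laplacian_apply_comp hv' x i, laplacian_apply_comp hv x i]
  refine Finset.sum_congr rfl fun j _ => ?_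
  rw [pderiv_apply_translate c i j]

/-- `div (v − c) = div v`, so translates of divergence-free fields are divergence free. [folklore] -/
theorem isDivFree_translate (hdiv : VectorCalculus.IsDivFree v) (c : EuclideanSpace ℝ (Fin 3)) :
    VectorCalculus.IsDivFree (fun y => v y - c) := by
  intro x
  unfold VectorCalculus.divergence
  rw [fderiv_sub_const]
  exact hdiv x

/-! ## The Galilean depletion constant -/

/-- **THE DEPLETION CONSTANT IS GALILEAN.** For a `C^∞` divergence-free field `v : ℝ³ → ℝ³` with
`‖Dv‖ ≤ B`, `D⁰v, D¹v, D²v ∈ L²`, and ANY constant vector `c` with `|v − c| ≤ M`: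
`|∫⟪curl v, Dv (curl v)⟫| ≤ ((2+√3)/9) · M · √(∫‖curl v‖²) · √(∫|∇ curl v|²_F)`.
The amplitude of the landed `abs_integral_stretching_le_strainCube_sharp` (`c = 0`) improves to the
Chebyshev radius `inf_c sup_x |v(x) − c|` of the range of `v`. Proof: the sharp strain-cube
interpolation for the translate `v − c` (same strain `sᵢⱼ`, same `Δ`, same `D¹, D²`), the Betchov–Miller
step and the `L²` identities for `v`. [folklore] -/
theorem abs_integral_stretching_le_strainCube_galilean (hv : ContDiff ℝ ∞ v)
    (hdiv : VectorCalculus.IsDivFree v) (c : EuclideanSpace ℝ (Fin 3))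
    {M B : ℝ} (hM : ∀ x, ‖v x - c‖ ≤ M) (hB : ∀ x, ‖fderiv ℝ v x‖ ≤ B)
    (h0 : ∫⁻ x, ‖iteratedFDeriv ℝ 0 v x‖ₑ ^ 2 < ⊤) (h1 : ∫⁻ x, ‖iteratedFDeriv ℝ 1 v x‖ₑ ^ 2 < ⊤)
    (h2 : ∫⁻ x, ‖iteratedFDeriv ℝ 2 v x‖ₑ ^ 2 < ⊤) :
    |∫ x, ⟪curl v x, fderiv ℝ v x (curl v x)⟫| ≤
      (2 + Real.sqrt 3) / 9 * M * Real.sqrt (∫ x, ‖curl v x‖ ^ 2) *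
        Real.sqrt (∫ x, frobeniusNormSq (fderiv ℝ (curl v) x)) := by
  set s : Fin 3 → Fin 3 → EuclideanSpace ℝ (Fin 3) → ℝ :=
    fun i j y => (pderiv j (fun z => v z i) y + pderiv i (fun z => v z j) y) / 2 with hsdef
  have hs : ∀ i j y, s i j y = (pderiv j (fun z => v z i) y + pderiv i (fun z => v z j) y) / 2 :=
    fun i j y => rfl
  -- the translate `v − c` and its data
  set v' : EuclideanSpace ℝ (Fin 3) → EuclideanSpace ℝ (Fin 3) := fun y => v y - c with hv'def
  have hv' : ContDiff ℝ ∞ v' := hv.sub contDiff_const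
  have hdiv' : VectorCalculus.IsDivFree v' := isDivFree_translate hdiv c
  have hM' : ∀ x, ‖v' x‖ ≤ M := hM
  have hB' : ∀ x, ‖fderiv ℝ v' x‖ ≤ B := fun x => by
    rw [hv'def, fderiv_translate]; exact hB x
  have h1' : ∫⁻ x, ‖iteratedFDeriv ℝ 1 v' x‖ₑ ^ 2 < ⊤ := by
    rw [hv'def, iteratedFDeriv_translate c 0]; exact h1
  have h2' : ∫⁻ x, ‖iteratedFDeriv ℝ 2 v' x‖ₑ ^ 2 < ⊤ := by
    rw [hv'def, iteratedFDeriv_translate c 1]; exact h2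
  have hs' : ∀ i j y, s i j y = (pderiv j (fun z => v' z i) y + pderiv i (fun z => v' z j) y) / 2 := by
    intro i j y
    rw [hv'def, pderiv_apply_translate c i j, pderiv_apply_translate c j i]
  have hM0 : 0 ≤ M := (norm_nonneg _).trans (hM 0)
  set Z := ∫ x, ‖curl v x‖ ^ 2 with hZ
  set W := ∫ x, frobeniusNormSq (fderiv ℝ (curl v) x) with hW
  have hB0 : ∀ x, ‖v x‖ ≤ M + ‖c‖ := fun x => by
    have h' : ‖v x‖ ≤ ‖v x - c‖ + ‖c‖ := by
      simpa using norm_le_norm_sub_add (v x) c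
    linarith [hM x]
  have hA := abs_integral_stretching_le_integral_cube hv hdiv hB0 hB h1 hs
  have hI := integral_strainCube_le_sharp hv' hdiv' hM' hB' h1' h2' hs'
  have hL : Δ v' = Δ v := by
    rw [hv'def]; exact laplacian_translate (hv.of_le (by norm_cast)) c
  rw [hL] at hI
  have e1 : ∫ x, ∑ i, ∑ j, s i j x ^ 2 = (1 / 2) * Z := integral_sumSq_sym_eq_half hv hdiv h0 h1 hs
  have e2 : ∫ x, ∑ l, ∑ i, ∑ j, pderiv l (s i j) x ^ 2 = (1 / 2) * W :=
    integral_gradSq_sym_eq_half hv hdiv h1 h2 hs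
  have e3 : ∫ x, ‖(Δ v) x‖ ^ 2 = W := integral_norm_laplacian_sq_eq hv hdiv h1 h2
  rw [e1, e2, e3] at hI
  have hc : 0 ≤ (2 / 9) * Real.sqrt 6 := by positivity
  calc |∫ x, ⟪curl v x, fderiv ℝ v x (curl v x)⟫|
      ≤ (2 / 9) * Real.sqrt 6 * ∫ x, (∑ i, ∑ j, s i j x ^ 2) * Real.sqrt (∑ i, ∑ j, s i j x ^ 2) := hA
    _ ≤ (2 / 9) * Real.sqrt 6 * (M * ((1 / 2) * Real.sqrt W * Real.sqrt ((1 / 2) * Z) +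
          Real.sqrt (2 / 3) * Real.sqrt ((1 / 2) * Z) * Real.sqrt ((1 / 2) * W))) :=
        mul_le_mul_of_nonneg_left hI hc
    _ = (2 + Real.sqrt 3) / 9 * M * Real.sqrt Z * Real.sqrt W := by
        rw [show (2 / 9) * Real.sqrt 6 * (M * ((1 / 2) * Real.sqrt W * Real.sqrt ((1 / 2) * Z) +
            Real.sqrt (2 / 3) * Real.sqrt ((1 / 2) * Z) * Real.sqrt ((1 / 2) * W))) =
            M * ((2 / 9) * Real.sqrt 6 * ((1 / 2) * Real.sqrt W * Real.sqrt ((1 / 2) * Z) +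
            Real.sqrt (2 / 3) * Real.sqrt ((1 / 2) * Z) * Real.sqrt ((1 / 2) * W))) by ring,
          depletion_constant_sharp_eq Z W]
        ring

/-- **The Galilean depletion constant, oscillation form.** Under the same hypotheses, if the range of
`v` has diameter at most `D` (`|v(x) − v(y)| ≤ D` for all `x, y`), then
`|∫⟪curl v, Dv (curl v)⟫| ≤ ((2+√3)/9) · D · √(∫‖curl v‖²) · √(∫|∇ curl v|²_F)` — take `c = v(0)`.
(The Chebyshev radius is at most the diameter; Jung's constant `√(3/8)·D` would need the
circumcentre, not used here.) [folklore] -/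
theorem abs_integral_stretching_le_strainCube_oscillation (hv : ContDiff ℝ ∞ v)
    (hdiv : VectorCalculus.IsDivFree v)
    {D B : ℝ} (hD : ∀ x y, ‖v x - v y‖ ≤ D) (hB : ∀ x, ‖fderiv ℝ v x‖ ≤ B)
    (h0 : ∫⁻ x, ‖iteratedFDeriv ℝ 0 v x‖ₑ ^ 2 < ⊤) (h1 : ∫⁻ x, ‖iteratedFDeriv ℝ 1 v x‖ₑ ^ 2 < ⊤)
    (h2 : ∫⁻ x, ‖iteratedFDeriv ℝ 2 v x‖ₑ ^ 2 < ⊤) :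
    |∫ x, ⟪curl v x, fderiv ℝ v x (curl v x)⟫| ≤
      (2 + Real.sqrt 3) / 9 * D * Real.sqrt (∫ x, ‖curl v x‖ ^ 2) *
        Real.sqrt (∫ x, frobeniusNormSq (fderiv ℝ (curl v) x)) :=
  abs_integral_stretching_le_strainCube_galilean hv hdiv (v 0) (fun x => hD x 0) hB h0 h1 h2

end Summit.NavierStokesRegularity.NavierStokesRegularity.Theorems.DepletionLadder.StrainCube

end
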